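import Summits.MatrixMultiplication.MatrixMultiplication.Theses.TropicalBiniPatterns
import Literature.Computability.AlgebraicComplexity.BorderRankMatMulTwoApolarity

/-!
# `TropicalBiniPatterns.TwoByTwoSeven` (stmt-MatrixMultiplication-8012) — proved

Route `MatrixMultiplication/TropicalBiniPatterns`, support item `TwoByTwoSeven` (card C3, the
calibration cell of the exhaustion mode): `7 ≤ R̲(⟨2,2,2⟩)` for the tree's ALGEBRAIC border rank
`algBorderRank` over `ℂ[ε]` (Bläser 2013, Def. 6.1) — Landsberg's theorem "the border rank of the
multiplication of `2 × 2` matrices is seven" (J. Amer. Math. Soc. 19 (2006) 447–459), lower half.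

Proof.  The library already proves the lower bound over every field of characteristic `0`:
`Literature.Computability.AlgebraicComplexity.MatMulTwo.seven_le_algBorderRank_matMulTensor_two`
(`BorderRankMatMulTwoApolarity.lean`; torus-fixed border apolarity after Conner–Harper–Landsberg
2023, §5, with the kernel-checked `(210)/(120)` rank certificate `MatMulTwo.rank_test_ge` of
`BorderRankMatMulTwoCert.lean`).  The item is its specialisation to `K = ℂ`.
-/

-- the tree's namespace `Summit.MatrixMultiplication.MatrixMultiplication.…` repeats a component by design
set_option linter.dupNamespace false

namespace Summit.MatrixMultiplication.MatrixMultiplication.Theorems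

open Literature.Computability.AlgebraicComplexity

/-- **`R̲(⟨2,2,2⟩) ≥ 7` over `ℂ[ε]`** (item `stmt-MatrixMultiplication-8012`, exact signature of
`TropicalBiniPatterns.TwoByTwoSeven`): the `2 × 2` matrix multiplication tensor admits no order-`h`
approximate decomposition with `6` triads, for any `h` — Landsberg 2006, here through the tree's
`MatMulTwo.seven_le_algBorderRank_matMulTensor_two` (torus-fixed border apolarity, after
Conner–Harper–Landsberg 2023, §5). [cite: Landsberg2005, main theorem (p. 447)]
[cite: ConnerHarperLandsberg2023, §5] -/
theorem twoByTwoSeven_proof :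
    Summit.MatrixMultiplication.MatrixMultiplication.Theses.TropicalBiniPatterns.TwoByTwoSeven := by
  unfold Summit.MatrixMultiplication.MatrixMultiplication.Theses.TropicalBiniPatterns.TwoByTwoSeven
  exact MatMulTwo.seven_le_algBorderRank_matMulTensor_two ℂ

end Summit.MatrixMultiplication.MatrixMultiplication.Theorems
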